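/-
Copyright (c) 2026 the pub-hodgecm-mathlib formalisation cell (harness21).  Prover seat hodgecm-mathlib-K2E5-p17 (g9), Track B «K2-LIT»,
#184♮ = hLiu418 = `stmt-HodgeConjecture-24832`; socket #41 — THE TOP, edition 20 «K0-mid = ONE LETTER»: edition 19 (pinned pole set) with the KIND-0 middle block (★ p862751 ED. 5's
18 visible letters) REPLACED by the ONE letter `hadapt` of ★ p862904 I4 ED. 6 «ARCH-ADAPTED DATUM» (K2E4-p11): archimedean Levi-adaptedness of `𝒦`; the socket-form twin is the
separate file `…TopTwentySocket` (400-line rule) (author of record by lineage).  THEOREMS ONLY; NO `Lines` import.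
-/
import Summits.HodgeConjecture.HodgeConjecture.Theorems.K2LiuSiegelEisensteinConstantTermFiniteness        -- ★ ed. 4a′ (this seat) ⊇ ed. 4a ⊇ ed. 3b
import Summits.HodgeConjecture.HodgeConjecture.Theorems.K2LiuSiegelEisensteinContinuationPoleSet          -- ★ (Q-P) road (i): `siegelEisensteinContinuation_of_kinds_fixedCarrier_poleSet` (ed. 3b with the pole set pinned)
import Summits.HodgeConjecture.HodgeConjecture.Theorems.K2LiuSiegelEisensteinKindZeroBigCellLetters         -- ★ p861499 `standardFamily_growth`
import Summits.HodgeConjecture.HodgeConjecture.Theorems.K2LiuSiegelEisensteinBigCellTermPackageCM          -- ★ p861474 `exists_bigCell_termPackage_cm` (P₈ = {½}, scalar b^S∕a^S)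
import Summits.HodgeConjecture.HodgeConjecture.Theorems.K2LiuKindOneLettersOfRecord                        -- ★ p862409 `exists_kindOne_sixLetters_of_record` (KIND 1 at the letters of record, F0P2-p11)
import Summits.HodgeConjecture.HodgeConjecture.Theorems.K2LiuKindOneWeightsOfDecay                         -- ★ p862451 `kindOne_weight_of_decay` (KIND-1 weights from (L-dec) + (L-supp), F0P2-p11 over ★ p862095)
import Summits.HodgeConjecture.HodgeConjecture.Theorems.K2LiuFourierCoeffDeltaContinuous                 -- ★ p861715 `continuous_fourierCoeffDelta_eisenstein{Series,Family}Delta` (`hRKc` paid)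
import Summits.HodgeConjecture.HodgeConjecture.Theorems.K2LiuSiegelEisensteinCoeffNondegenerateCurve      -- ★ Φ2 `fourierCoeffDelta_eisensteinFamilyDelta_eq_curve` (`E_S = (∫β)⁻¹·W_S`, `det S ≠ 0`)
import Summits.HodgeConjecture.HodgeConjecture.Theorems.K2LiuSiegelEisensteinMiddleTermOfStandardArch      -- ★ p862904 `exists_middleTerm_package_of_standard_arch` (I4 ED. 6 «ARCH-ADAPTED DATUM», K2E4-p11 ⊇ ★ ED. 5 p862751, ★ p862830 datum, ★ p862786 preimage level, ★ p862873 (D1))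
import Summits.HodgeConjecture.HodgeConjecture.Theorems.K2LiuSiegelMiddleTermCharacterNormTrivial          -- ★ `toHeckeCharacter_inv_conj_mul_self_eq_one` (`hχc` of I4 at `χ = toHeckeCharacter L lam⁻¹`)
import Summits.HodgeConjecture.HodgeConjecture.Theorems.K2LiuSiegelEisensteinWhittakerFactorLetters        -- ★ p862137 `exists_whittaker_factorLetters_of_weightLetters` (KIND W ED. 2, F0P2-p08 ∘ K2E4-p10 ★ p862095)
import Summits.HodgeConjecture.HodgeConjecture.Theorems.K2LiuBigCellContinuation                            -- ★ (β) END `exists_bigCell_continuation_cm` (K2Liu-p13 (g4); ⊇ ★ p862134, (E10), (E10a), (F-GK-4) ED. 3, p862168, p862179)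
import Summits.HodgeConjecture.HodgeConjecture.Theorems.K2LiuSiegelEisensteinWhittakerTermPackageFixedCarrier  -- ★ p861446 `exists_whittaker_packages_fourierCoeff_fixedCarrier`
import Summits.HodgeConjecture.HodgeConjecture.Theorems.K2LiuSiegelEisensteinWhittakerMajorant              -- ★ p861512 `whittaker_majorant∕summedGrowth_of_weightedGrowth`
import HarnessLib

/-!
# Crux `HLiu418`, socket #41 — THE TOP, edition 20 «K0-mid = ONE LETTER»: edition 19 with the KIND-0 middle block REPLACED by the single letter `hadapt` of ★ p862904 I4 ED. 6

Cell `hodgecm-mathlib`, crux item hLiu418 = `stmt-HodgeConjecture-24832` (helper lane until the typist's tie; count-neutral).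

THE MIDDLE TERM AT AN ARCHIMEDEAN-LEVI-ADAPTED STANDARD DATUM (★ p862904 `K2LiuSiegelEisensteinMiddleTermOfStandardArch.exists_middleTerm_package_of_standard_arch`, K2E4-p11 (g8),
over ★ ED. 5 p862751, ★ p862830 `exists_middleTerm_datum` (`g₀ Λ Γ₀ β₁ F` constructed), ★ p862786 `exists_preimageLevel` (`KG hKGo hKGfi hΛK` from `hadapt`), ★ p862873 (D1)
`hint_and_hFhol_of_standard'`).  The whole K0-mid block of ★ ED. 17–19 (`{g₀} χ₀ hχ₀ hg₀ Λ hΛ hΛc KG hKGo hKGfi hΛK Γ₀ hΓ₀ {β₁} hβ₁ F hF hint hFhol`) collapses to ONE LETTER, stated at the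
socket's generic `n`: **`hadapt`** — for every Levi chart `Λ : GL_n(𝔸_L) →* H(𝔸)` with ★ α3-2's block equation and every `k ∈ K_{GL_n}`, the archimedean component of `Λ k` lies in
`𝒦.K`.  It is NOT true for every standard datum (RULING M-158j ∕ BATCH #70): it holds at the (R-c)-ADAPTED datum ((T3-arch) ★ p862756 `K2LiuArchMajorantTransitivity`, LH4-p17's
`K2LiuLeviChartArchCompactOfRecord`), and socket #41 at every standard datum follows by ★ p862487 (T) `continuation_transport` + ★ p862557 `isStd_conj` — the tie's business.
INSIDE BY NAME: `n = 2`, `hχc` ★ `toHeckeCharacter_inv_conj_mul_self_eq_one hlam`, ★ p862904 ⇒ `(E₇, h7d, h7c, h7eq, h7g)`; everything else as edition 19 (KIND 1 at the letters of record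
★ p862409 ∕ ★ p862451; big cell ★ (β) END p862797 → ★ p861474; KIND W ★ p862137; identity cell ★ p861499; O41.4 ★ ed. 4a′; KIND-0 assembly ★ ed. 4a) into ★ p862918
`siegelEisensteinContinuation_of_kinds_fixedCarrier_poleSet` at `P := {½}`.
WHAT REMAINS BY VALUE (K2E3-typ2's block names): C carrier 9 (tie-paid) · K0-a `(wq hwq) {S} hS hur` 5 (tie-paid) · K0-β `hram hArch` 2 (`hram` tie-paid) · **K0-mid `hadapt` 1** ·
K1-b♮ 12 · K1-a♮ 12 · KW 13 — 54 slots, 39 open letters in four organs (`hArch`, `hadapt`, K1-b♮, K1-a♮, KW).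
HEADS: **`siegelEisensteinContinuation_twenty_poleSet`** (this file: `∃ Es` with (iv) at `P = {½}`); the socket form `…TopTwentySocket.siegelEisensteinContinuation_twenty` (twin file,
two-line corollary) ⇒ socket #41's body BYTES VERBATIM.
Sources: [Tan1999, §1 Main Theorem; §3; §4 Props. 4.1, 4.4, 4.8]; [MoeglinWaldspurger1995, I.2.6, II.1.7, IV.1.8–IV.1.11]; [KudlaRallis1994, §1–§2, (2.10)–(2.12)]; [KudlaSweet1997, §1];
[HarrisKudlaSweet1996, §6 (6.14)–(6.16)]; [BorelJacquet1979, §1.1, §4.1]; [Shimura1997, §18.4, Prop. 18.14]; [Liu2021, Lem. B.10 (2), B.12].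
HONEST LABEL.  Count-neutral helper until tied; `HC_CM` is proved only modulo the 7 printed citations (2 remaining named inputs: hLiu418 = `stmt-HodgeConjecture-24832`,
h413 = `stmt-HodgeConjecture-24833`) until rung 0 closes.
-/

set_option autoImplicit false
set_option linter.dupNamespace false -- the mandated namespace repeats `HodgeConjecture.HodgeConjecture`

noncomputable section

open scoped Matrix Topology ENNReal NNReal BigOperators ComplexConjugate
open NumberField IsDedekindDomain MeasureTheory Filter
open Literature.NumberTheory.Automorphic Literature.NumberTheory.GaloisRepresentations
open Literature.NumberTheory.GelbartRogawski1991 Literature.NumberTheory.GelbartRogawski1991.GRConstruction Literature.NumberTheory.GelbartRogawski1991.AdaptedBlocks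
open Literature.NumberTheory.K2Lit.SiegelDoubled Literature.MeasureTheory.Group
open Literature.NumberTheory.Automorphic.IdeleClassGroup

namespace Summit.HodgeConjecture.HodgeConjecture.Cruxes.HLiu418.K2LiuSiegelEisensteinContinuationTopTwenty

open K2LiuSiegelUnipotentFourierDefs K2LiuSiegelUnipotentLocalDefs K2LiuSiegelEisensteinContinuationTopKinds K2LiuSiegelEisensteinContinuationPoleSet K2LiuSiegelEisensteinConstantTermPackage K2LiuSiegelEisensteinConstantTermFiniteness
open K2LiuSiegelEisensteinKindZeroBigCellLetters (standardFamily_growth)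
open K2LiuSiegelEisensteinBigCellTermPackageCM (exists_bigCell_termPackage_cm)
open K2LiuKindOneLettersOfRecord (exists_kindOne_sixLetters_of_record)
open K2LiuKindOneWeightsOfDecay (kindOne_weight_of_decay)
open K2LiuFourierCoeffDeltaContinuous (continuous_fourierCoeffDelta_eisensteinSeriesDelta)
open K2LiuSiegelEisensteinCoeffNondegenerateCurve (fourierCoeffDelta_eisensteinFamilyDelta_eq_curve)
open K2LiuSiegelEisensteinMiddleTermOfStandardArch (exists_middleTerm_package_of_standard_arch)
open K2LiuSiegelMiddleTermCharacterNormTrivial (toHeckeCharacter_inv_conj_mul_self_eq_one)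
open K2LiuSiegelEisensteinWhittakerFactorLetters (exists_whittaker_factorLetters_of_weightLetters)
open K2LiuBigCellContinuation (exists_bigCell_continuation_cm)
open K2LiuSiegelEisensteinWhittakerTermPackageFixedCarrier (exists_whittaker_packages_fourierCoeff_fixedCarrier)
open K2LiuSiegelEisensteinWhittakerMajorant (whittaker_majorant_of_weightedGrowth whittaker_summedGrowth_of_weightedGrowth)

open Classical in
/-- **SOCKET #41 WITH THE POLE SET PINNED, K0-mid = ONE LETTER (edition 20).**  Binders: socket prefix; carrier; `wq hwq`; `{S} hS hur hram hArch` ((β) END ★ p862797's letters);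
**`hadapt`** (archimedean Levi-adaptedness of `𝒦`, the one visible letter of ★ p862904 I4 ED. 6, at generic `n`); K1-b♮; K1-a♮; KW (as ★ ed. 16–19).  Conclusion: `∃ Es`, (A1)–(A3),
**(A4) `Es s h = (∏_{p ∈ {½}}(s − p))·E^Δ(h; f_s)` on `{n∕2 < re s}`**, (A5).  Inside: `n = 2`, `hχc`, ★ p862904 ⇒ `E₇`; rest as edition 19 into ★ p862918 at `{½}`.
[cite: Tan1999, §1 Main Theorem; §4 Props. 4.1, 4.4, 4.8] [cite: MoeglinWaldspurger1995, I.2.6, II.1.7, IV.1.8–IV.1.11] [cite: KudlaRallis1994, §1–§2, (2.10)–(2.12)]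
[cite: HarrisKudlaSweet1996, §6 (6.14)–(6.16)] [cite: BorelJacquet1979, §1.1, §4.1] [cite: Shimura1997, §18.4, Prop. 18.14] [cite: Liu2021, Lem. B.10 (2), B.12] -/
theorem siegelEisensteinContinuation_twenty_poleSet
    (L : Type) [Field L] [NumberField L] [IsCMField L] {n : ℕ} (e : Fin 2 × Fin 1 ≃ Fin n)
    (dV : Fin 2 → L) (hdV : ∀ i, IsCMField.complexConj L (dV i) = dV i) (hdV0 : ∀ i, dV i ≠ 0)
    (dW : Fin 1 → L) (hdW : ∀ i, IsCMField.complexConj L (dW i) = dW i) (hdW0 : ∀ i, dW i ≠ 0)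
    (lam : IdeleClassGroup L →ₜ* Circle) (hlam : IsConjugateSymplectic L lam) (hw : HasWeight L lam 1)
    (𝒦 : IwasawaDatum L e dV hdV dW hdW) (h𝒦 : 𝒦.IsStd) (f : ℂ → HA L e dV hdV dW hdW → ℂ)
    (hstd : IsStandardSectionFamily 𝒦 (toHeckeCharacter L lam⁻¹) f) (hcont : ∀ s, Continuous (f s))
    -- the carrier (built by the tie as in ★ edition 2: Haar + ★ (C0) + ★ covering weight)
    [MeasurableSpace (unipDelta L e dV hdV dW hdW)] [BorelSpace (unipDelta L e dV hdV dW hdW)]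
    (νN : Measure (unipDelta L e dV hdV dW hdW)) [νN.IsHaarMeasure]
    (β : unipDelta L e dV hdV dW hdW → ℝ≥0∞) (hβ : IsCoveringWeight (unipDeltaRat L e dV hdV dW hdW) β)
    (hβ0 : ∫⁻ u, β u ∂νN ≠ 0) (hβtop : ∫⁻ u, β u ∂νN ≠ ∞)
    {K : Set (unipDelta L e dV hdV dW hdW)} (hK : IsCompact K) (hβK : ∀ u, β u ≤ K.indicator 1 u)
    -- KIND 0: rational Weyl presentation; big cell = ★ p861474's continuation letters `(S, hS, hur, E, hEd, hEeq)`; middle package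
    (wq : unipDeltaRat L e dV hdV dW hdW → ratH L e dV hdV dW hdW)
    (hwq : ∀ ν, ((wq ν : ratH L e dV hdV dW hdW) : HA L e dV hdV dW hdW) = weylDelta L e dV hdV dW hdW * ((ν : unipDelta L e dV hdV dW hdW) : HA L e dV hdV dW hdW))
    {S : Set (HeightOneSpectrum (𝓞 ↥(maximalRealSubfield L)))} (hS : S.Finite) (hur : ∀ v ∉ S, (quadraticHeckeCharCM L).IsUnramifiedAt v)
    -- KIND 0 big cell: ★ (β) END `K2LiuBigCellContinuation.exists_bigCell_continuation_cm` (K2Liu-p13) — ramification EXACTLY on `S` (`hram`) and THE ARCHIMEDEAN FACE BY VALUE ((E8) END, K2Liu-p11):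
    -- for every standard datum, every (E6′) arch datum `(s₀, A)` and every `κ`, the arch block of the big cell is integrable on `1 < re s` with a holomorphic integral on `{0 < re}`
    (hram : ∀ v ∈ S, ¬ (quadraticHeckeCharCM L).IsUnramifiedAt v)
    (hArch : ∀ (𝒦' : IwasawaDatum L e dV hdV dW hdW), 𝒦'.IsStd →
      ∀ (s₀ : ℂ) (A : UnitaryGroup.arch (Fp L) L (IsCMField.complexConj L) (n + n) (hermD L e dV hdV dW hdW) → ℂ),
        (∀ p : HA L e dV hdV dW hdW, IsSiegelDelta L e dV hdV dW hdW p → UnitaryGroup.finPart (Fp L) L (IsCMField.complexConj L) (n + n) (hermD L e dV hdV dW hdW) p = 1 →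
          ∀ x : UnitaryGroup.arch (Fp L) L (IsCMField.complexConj L) (n + n) (hermD L e dV hdV dW hdW),
            A (UnitaryGroup.archPart (Fp L) L (IsCMField.complexConj L) (n + n) (hermD L e dV hdV dW hdW) p * x) = siegelDeltaCharacter L e dV hdV dW hdW (toHeckeCharacter L lam⁻¹) s₀ p * A x) →
        (∃ V : Submodule ℂ (UnitaryGroup.arch (Fp L) L (IsCMField.complexConj L) (n + n) (hermD L e dV hdV dW hdW) → ℂ), FiniteDimensional ℂ V ∧ A ∈ V ∧
          ∀ a₀ : UnitaryGroup.arch (Fp L) L (IsCMField.complexConj L) (n + n) (hermD L e dV hdV dW hdW),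
            (UnitaryGroup.archToAdelic (Fp L) L (IsCMField.complexConj L) (n + n) (hermD L e dV hdV dW hdW) a₀ : HA L e dV hdV dW hdW) ∈ 𝒦'.K → ∀ G ∈ V, (fun x => G (x * a₀)) ∈ V) →
        Continuous A →
        ∀ κ : HA L e dV hdV dW hdW, κ ∈ 𝒦'.K →
          ∀ {_ : MeasurableSpace ↥(unipDeltaArch L e dV hdV dW hdW)} [BorelSpace ↥(unipDeltaArch L e dV hdV dW hdW)]
            (νinf : Measure ↥(unipDeltaArch L e dV hdV dW hdW)) [νinf.IsHaarMeasure] [SigmaFinite νinf],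
            (∀ s : ℂ, 1 < s.re → Integrable (fun p : ↥(unipDeltaArch L e dV hdV dW hdW) =>
              ((modDelta L e dV hdV dW hdW (𝒦'.pPart (UnitaryGroup.archToAdelic (Fp L) L (IsCMField.complexConj L) (n + n) (hermD L e dV hdV dW hdW)
                  (UnitaryGroup.archPart (Fp L) L (IsCMField.complexConj L) (n + n) (hermD L e dV hdV dW hdW) (weylDelta L e dV hdV dW hdW) *
                    (p : UnitaryGroup.arch (Fp L) L (IsCMField.complexConj L) (n + n) (hermD L e dV hdV dW hdW)) *
                    UnitaryGroup.archPart (Fp L) L (IsCMField.complexConj L) (n + n) (hermD L e dV hdV dW hdW) κ))) : ℝ) : ℂ) ^ (2 * (s - s₀)) *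
                A (UnitaryGroup.archPart (Fp L) L (IsCMField.complexConj L) (n + n) (hermD L e dV hdV dW hdW) (weylDelta L e dV hdV dW hdW) *
                    (p : UnitaryGroup.arch (Fp L) L (IsCMField.complexConj L) (n + n) (hermD L e dV hdV dW hdW)) *
                    UnitaryGroup.archPart (Fp L) L (IsCMField.complexConj L) (n + n) (hermD L e dV hdV dW hdW) κ)) νinf) ∧
            ∃ Ea : ℂ → ℂ, DifferentiableOn ℂ Ea {s : ℂ | 0 < s.re} ∧ ∀ s : ℂ, 1 < s.re →
              ∫ p : ↥(unipDeltaArch L e dV hdV dW hdW),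
                ((modDelta L e dV hdV dW hdW (𝒦'.pPart (UnitaryGroup.archToAdelic (Fp L) L (IsCMField.complexConj L) (n + n) (hermD L e dV hdV dW hdW)
                  (UnitaryGroup.archPart (Fp L) L (IsCMField.complexConj L) (n + n) (hermD L e dV hdV dW hdW) (weylDelta L e dV hdV dW hdW) *
                    (p : UnitaryGroup.arch (Fp L) L (IsCMField.complexConj L) (n + n) (hermD L e dV hdV dW hdW)) *
                    UnitaryGroup.archPart (Fp L) L (IsCMField.complexConj L) (n + n) (hermD L e dV hdV dW hdW) κ))) : ℝ) : ℂ) ^ (2 * (s - s₀)) *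
                A (UnitaryGroup.archPart (Fp L) L (IsCMField.complexConj L) (n + n) (hermD L e dV hdV dW hdW) (weylDelta L e dV hdV dW hdW) *
                    (p : UnitaryGroup.arch (Fp L) L (IsCMField.complexConj L) (n + n) (hermD L e dV hdV dW hdW)) *
                    UnitaryGroup.archPart (Fp L) L (IsCMField.complexConj L) (n + n) (hermD L e dV hdV dW hdW) κ) ∂νinf = Ea s)
    -- KIND 0 middle term: ★ p862904 (K2E4-p11) I4 ED. 6 «ARCH-ADAPTED DATUM» — ONE LETTER, stated at the socket's generic `n` (`= 2`): ARCHIMEDEAN LEVI-ADAPTEDNESS of `𝒦`: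
    -- for every Levi chart `Λ : GL_n(𝔸_L) →* H(𝔸)` (block equation of ★ α3-2) and every `k ∈ K_{GL_n} = GL_n(𝒪̂_L)·K_∞`, the archimedean component of `Λ k` lies in `𝒦.K`
    -- (inhabited at the (R-c)-adapted datum: (T3-arch) ★ p862756 + LH4-p17 `K2LiuLeviChartArchCompactOfRecord`; transported by ★ p862487 (T) + ★ p862557 §5)
    (hadapt : ∀ (Λ : GL (Fin n) (AdeleRing (𝓞 L) L) →* HA L e dV hdV dW hdW),
      (∀ g : GL (Fin n) (AdeleRing (𝓞 L) L), blk L e dV hdV dW hdW (Λ g) =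
        cayR (AdeleRing (𝓞 L) L) (Fin n) * Matrix.fromBlocks (g : Matrix (Fin n) (Fin n) (AdeleRing (𝓞 L) L)) 0 0
          (((gramR L e dV hdV dW hdW).map ((algebraMap L (AdeleRing (𝓞 L) L)).comp (algebraMap (Fp L) L)))⁻¹ *
            (((g⁻¹ : GL (Fin n) (AdeleRing (𝓞 L) L)) : Matrix (Fin n) (Fin n) (AdeleRing (𝓞 L) L)).map
              (UnitaryGroup.conjAdele (Fp L) L (IsCMField.complexConj L)))ᵀ *
            (gramR L e dV hdV dW hdW).map ((algebraMap L (AdeleRing (𝓞 L) L)).comp (algebraMap (Fp L) L))) *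
          cayRinv (AdeleRing (𝓞 L) L) (Fin n)) →
      ∀ k : ↥(standardMaximalCompactGL n L),
        (UnitaryGroup.archToAdelic (Fp L) L (IsCMField.complexConj L) (n + n) (hermD L e dV hdV dW hdW)
          (UnitaryGroup.archPart (Fp L) L (IsCMField.complexConj L) (n + n) (hermD L e dV hdV dW hdW) (Λ (k : GL (Fin n) (AdeleRing (𝓞 L) L)))) :
            HA L e dV hdV dW hdW) ∈ 𝒦.K)
    -- KIND 1: THE LETTERS OF RECORD (★ p862409: `ι := Unit`, `a := 1`, `ρb := 1`, `ρa S s := (s − ½)⁻¹`, `G := 1`) — two ONE-FUNCTION packages, each: the function, its holomorphy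
    -- on `{0 < re}`, its PIN at THIS carrier `(νN, β)` on `{n∕2 < re s}` for rank-one `S`, (L-dec) height-form Gaussian decay in its own size `τ ≥ ‖S‖_∞`, (L-supp) support
    -- K1-b♮: the continued NORMALISED MIDDLE-CELL (line) term `Ebc` (`MID_S` with O41.4's rational Weyl presentation `wq`)
    (Ebc : skewMatrices ((IsCMField.complexConj L : L ≃ₐ[Fp L] L) : L →+* L) ((gramR L e dV hdV dW hdW).map (algebraMap (Fp L) L)) → ℂ → HA L e dV hdV dW hdW → ℂ)
    (hEbd : ∀ S x, DifferentiableOn ℂ (fun s => Ebc S s x) {s : ℂ | 0 < s.re})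
    (hEbc : ∀ S : skewMatrices ((IsCMField.complexConj L : L ≃ₐ[Fp L] L) : L →+* L) ((gramR L e dV hdV dW hdW).map (algebraMap (Fp L) L)),
      (S : Matrix (Fin n) (Fin n) L) ≠ 0 → (S : Matrix (Fin n) (Fin n) L).det = 0 → ∀ (s : ℂ) (h : HA L e dV hdV dW hdW), (n : ℝ) / 2 < s.re →
        ((∫⁻ u, β u ∂νN).toReal⁻¹ : ℝ) •
          (∫ u, (β u).toReal • (conj (unipDeltaChar L e dV hdV dW hdW (S : Matrix (Fin n) (Fin n) L) (u : HA L e dV hdV dW hdW) : ℂ) *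
            (∑' q : ↥(({Quotient.mk (MulAction.orbitRel (siegelDeltaRat L e dV hdV dW hdW) (ratH L e dV hdV dW hdW)) 1} ∪
              Set.range (fun ν : unipDeltaRat L e dV hdV dW hdW =>
                (Quotient.mk (MulAction.orbitRel (siegelDeltaRat L e dV hdV dW hdW) (ratH L e dV hdV dW hdW)) (wq ν) :
                  SiegelDeltaQuot L e dV hdV dW hdW)))ᶜ : Set (SiegelDeltaQuot L e dV hdV dW hdW)),
              f s ((((Quotient.out (q : SiegelDeltaQuot L e dV hdV dW hdW) : ratH L e dV hdV dW hdW) : HA L e dV hdV dW hdW)) *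
                ((u : HA L e dV hdV dW hdW) * h)))) ∂νN) = Ebc S s h)
    (τb : skewMatrices ((IsCMField.complexConj L : L ≃ₐ[Fp L] L) : L →+* L) ((gramR L e dV hdV dW hdW).map (algebraMap (Fp L) L)) → ℝ)
    (hτb : ∀ S : skewMatrices ((IsCMField.complexConj L : L ≃ₐ[Fp L] L) : L →+* L) ((gramR L e dV hdV dW hdW).map (algebraMap (Fp L) L)),
      ‖(fun i j => NumberField.mixedEmbedding L ((S : Matrix (Fin n) (Fin n) L) i j))‖ ≤ τb S) (Nb : ℕ)
    (hdecb : ∀ z : ℂ, 0 < z.re → ∃ C a c a' r : ℝ, 0 ≤ C ∧ 0 ≤ a ∧ 0 < c ∧ 0 ≤ a' ∧ 0 < r ∧ ∀ S (s : ℂ), dist s z < r → ∀ h : HA L e dV hdV dW hdW,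
      ‖Ebc S s h‖ ≤ C * adelicHeightGL (n + n) L (h : GL (Fin (n + n)) (AdeleRing (𝓞 L) L)) ^ a *
        (Real.exp (-(c * adelicHeightGL (n + n) L (h : GL (Fin (n + n)) (AdeleRing (𝓞 L) L)) ^ (-a') * τb S)) * (1 + τb S) ^ Nb))
    {Cb κb : ℝ} (hCb : 0 < Cb) (hκb : 0 ≤ κb)
    (hsuppb : ∀ S (s : ℂ) (h : HA L e dV hdV dW hdW), 0 < s.re → Ebc S s h ≠ 0 →
      ∃ D : ℕ, 1 ≤ D ∧ (D : ℝ) ≤ Cb * adelicHeightGL (n + n) L (h : GL (Fin (n + n)) (AdeleRing (𝓞 L) L)) ^ κb ∧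
        ∀ i j, IsIntegral ℤ ((D : L) * (S : Matrix (Fin n) (Fin n) L) i j))
    -- K1-a♮: the continued `(s − ½)·`NORMALISED WHITTAKER (singular) term `Eac`
    (Eac : skewMatrices ((IsCMField.complexConj L : L ≃ₐ[Fp L] L) : L →+* L) ((gramR L e dV hdV dW hdW).map (algebraMap (Fp L) L)) → ℂ → HA L e dV hdV dW hdW → ℂ)
    (hEad : ∀ S x, DifferentiableOn ℂ (fun s => Eac S s x) {s : ℂ | 0 < s.re})
    (hEac : ∀ S : skewMatrices ((IsCMField.complexConj L : L ≃ₐ[Fp L] L) : L →+* L) ((gramR L e dV hdV dW hdW).map (algebraMap (Fp L) L)),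
      (S : Matrix (Fin n) (Fin n) L) ≠ 0 → (S : Matrix (Fin n) (Fin n) L).det = 0 → ∀ (s : ℂ) (h : HA L e dV hdV dW hdW), (n : ℝ) / 2 < s.re →
        (s - 1 / 2) * (((∫⁻ u, β u ∂νN).toReal⁻¹ : ℝ) • whittakerDelta L e dV hdV dW hdW νN (S : Matrix (Fin n) (Fin n) L) (f s) h) = Eac S s h)
    (τa : skewMatrices ((IsCMField.complexConj L : L ≃ₐ[Fp L] L) : L →+* L) ((gramR L e dV hdV dW hdW).map (algebraMap (Fp L) L)) → ℝ)
    (hτa : ∀ S : skewMatrices ((IsCMField.complexConj L : L ≃ₐ[Fp L] L) : L →+* L) ((gramR L e dV hdV dW hdW).map (algebraMap (Fp L) L)),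
      ‖(fun i j => NumberField.mixedEmbedding L ((S : Matrix (Fin n) (Fin n) L) i j))‖ ≤ τa S) (Na : ℕ)
    (hdeca : ∀ z : ℂ, 0 < z.re → ∃ C a c a' r : ℝ, 0 ≤ C ∧ 0 ≤ a ∧ 0 < c ∧ 0 ≤ a' ∧ 0 < r ∧ ∀ S (s : ℂ), dist s z < r → ∀ h : HA L e dV hdV dW hdW,
      ‖Eac S s h‖ ≤ C * adelicHeightGL (n + n) L (h : GL (Fin (n + n)) (AdeleRing (𝓞 L) L)) ^ a *
        (Real.exp (-(c * adelicHeightGL (n + n) L (h : GL (Fin (n + n)) (AdeleRing (𝓞 L) L)) ^ (-a') * τa S)) * (1 + τa S) ^ Na))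
    {Ca κa : ℝ} (hCa : 0 < Ca) (hκa : 0 ≤ κa)
    (hsuppa : ∀ S (s : ℂ) (h : HA L e dV hdV dW hdW), 0 < s.re → Eac S s h ≠ 0 →
      ∃ D : ℕ, 1 ≤ D ∧ (D : ℝ) ≤ Ca * adelicHeightGL (n + n) L (h : GL (Fin (n + n)) (AdeleRing (𝓞 L) L)) ^ κa ∧
        ∀ i j, IsIntegral ℤ ((D : L) * (S : Matrix (Fin n) (Fin n) L) i j))
    -- KIND W: ★ p862137 (F0P2-p08 ∘ K2E4-p10) letters BY VALUE — Euler data `(A, U, hEuler)` at the Whittaker level, holomorphy `hAd`, and the three (W3) letters on `A`: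
    -- archimedean size `τ` with `hτ`, height-form Gaussian decay `hdec`, bounded-denominator support `hsupp`
    -- (W1) the EULER DATA by value: `T`-part `A` and exceptional place set `U(S,h) = D(S) ∪ T(S,h)`, with the Euler identity on `{n∕2 < re s}`
    (A : skewMatrices ((IsCMField.complexConj L : L ≃ₐ[Fp L] L) : L →+* L) ((gramR L e dV hdV dW hdW).map (algebraMap (Fp L) L)) → ℂ → HA L e dV hdV dW hdW → ℂ)
    (U : skewMatrices ((IsCMField.complexConj L : L ≃ₐ[Fp L] L) : L →+* L) ((gramR L e dV hdV dW hdW).map (algebraMap (Fp L) L)) → HA L e dV hdV dW hdW →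
      Set (HeightOneSpectrum (𝓞 ↥(maximalRealSubfield L))))
    (hEuler : ∀ S : skewMatrices ((IsCMField.complexConj L : L ≃ₐ[Fp L] L) : L →+* L) ((gramR L e dV hdV dW hdW).map (algebraMap (Fp L) L)),
      (S : Matrix (Fin n) (Fin n) L).det ≠ 0 → ∀ (s : ℂ) (h : HA L e dV hdV dW hdW), (n : ℝ) / 2 < s.re →
        whittakerDelta L e dV hdV dW hdW νN (S : Matrix (Fin n) (Fin n) L) (f s) h =
          A S s h * (partialStandardL (U S h) (fun _ => {1}) (2 * s + 1) *
            partialStandardL (U S h) (fun v => {(quadraticHeckeCharCM L).valueAtUniformizer v}) (2 * s + 2))⁻¹)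
    -- (W2) holomorphy of the `T`-part
    (hAd : ∀ S (h : HA L e dV hdV dW hdW), DifferentiableOn ℂ (fun s => A S s h) {s : ℂ | 0 < s.re})
    -- (W3) K2E4-p10 (g8)'s three letters on `A`
    (τ : skewMatrices ((IsCMField.complexConj L : L ≃ₐ[Fp L] L) : L →+* L) ((gramR L e dV hdV dW hdW).map (algebraMap (Fp L) L)) → ℝ)
    (hτ : ∀ S : skewMatrices ((IsCMField.complexConj L : L ≃ₐ[Fp L] L) : L →+* L) ((gramR L e dV hdV dW hdW).map (algebraMap (Fp L) L)),
      ‖(fun i j => NumberField.mixedEmbedding L ((S : Matrix (Fin n) (Fin n) L) i j))‖ ≤ τ S) (NW : ℕ)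
    (hdec : ∀ z : ℂ, 0 < z.re → ∃ C a c a' r : ℝ, 0 ≤ C ∧ 0 ≤ a ∧ 0 < c ∧ 0 ≤ a' ∧ 0 < r ∧ ∀ S (s : ℂ), dist s z < r → ∀ h : HA L e dV hdV dW hdW,
      ‖A S s h‖ ≤ C * adelicHeightGL (n + n) L (h : GL (Fin (n + n)) (AdeleRing (𝓞 L) L)) ^ a *
        (Real.exp (-(c * adelicHeightGL (n + n) L (h : GL (Fin (n + n)) (AdeleRing (𝓞 L) L)) ^ (-a') * τ S)) * (1 + τ S) ^ NW))
    {CW κ : ℝ} (hCW : 0 < CW) (hκ : 0 ≤ κ)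
    (hsupp : ∀ S (s : ℂ) (h : HA L e dV hdV dW hdW), 0 < s.re → A S s h ≠ 0 →
      ∃ D : ℕ, 1 ≤ D ∧ (D : ℝ) ≤ CW * adelicHeightGL (n + n) L (h : GL (Fin (n + n)) (AdeleRing (𝓞 L) L)) ^ κ ∧
        ∀ i j, IsIntegral ℤ ((D : L) * (S : Matrix (Fin n) (Fin n) L) i j)) :
    ∃ Es : ℂ → HA L e dV hdV dW hdW → ℂ,
      (∀ h : HA L e dV hdV dW hdW, DifferentiableOn ℂ (fun s => Es s h) {s : ℂ | 0 < s.re}) ∧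
      (∀ s : ℂ, 0 < s.re → Continuous (Es s)) ∧
      (∀ s : ℂ, 0 < s.re → ∀ (γ : ratH L e dV hdV dW hdW) (h : HA L e dV hdV dW hdW),
        Es s ((γ : HA L e dV hdV dW hdW) * h) = Es s h) ∧
      (∀ (s : ℂ) (h : HA L e dV hdV dW hdW), (n : ℝ) / 2 < s.re →
        Es s h = (∏ p ∈ ({(1 / 2 : ℂ)} : Finset ℂ), (s - p)) * eisensteinFamilyDelta L e dV hdV dW hdW f s h) ∧
      (∀ z : ℂ, 0 < z.re → ∃ C A r : ℝ, 0 < r ∧ ∀ s : ℂ, dist s z < r → ∀ h : HA L e dV hdV dW hdW,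
        ‖Es s h‖ ≤ C * adelicHeightGL (n + n) L (h : GL (Fin (n + n)) (AdeleRing (𝓞 L) L)) ^ A) := by
  have hn : 0 < n := by
    have h2 : Fintype.card (Fin 2 × Fin 1) = Fintype.card (Fin n) := Fintype.card_congr e
    simp only [Fintype.card_prod, Fintype.card_fin] at h2
    omega
  haveI : NeZero n := ⟨hn.ne'⟩
  have hχ : (toHeckeCharacter L lam⁻¹).IsUnitary := isUnitary_toHeckeCharacter L lam⁻¹
  -- KIND W: ★ p862052 factor letters (F0P2-p08), then the Whittaker level: `E_S = (∫β)⁻¹·W_S` (★ Φ2 under ★ ed. 4a′), `WT` rescaled by `c := (∫β)⁻¹`; ★ p861446, ★ p861512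
  obtain ⟨WT, GW, w, hWTd, hGWd, hw0, hws, hg, hRKW⟩ :=
    exists_whittaker_factorLetters_of_weightLetters L hn e dV hdV dW hdW f νN A U hEuler hAd τ hτ NW hdec hCW hκ hsupp
  set c : ℝ := (∫⁻ u, β u ∂νN).toReal⁻¹ with hc
  have hWTd' : ∀ S (h : HA L e dV hdV dW hdW), DifferentiableOn ℂ (fun s => (c : ℂ) * WT S s h) {s : ℂ | 0 < s.re} :=
    fun S h => (hWTd S h).const_mul _
  have hg' : ∀ z : ℂ, 0 < z.re → ∃ C A r : ℝ, 0 ≤ C ∧ 0 ≤ A ∧ 0 < r ∧ ∀ S (s : ℂ), dist s z < r → ∀ h : HA L e dV hdV dW hdW,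
      ‖(c : ℂ) * WT S s h * GW S s h‖ ≤ C * w S * adelicHeightGL (n + n) L (h : GL (Fin (n + n)) (AdeleRing (𝓞 L) L)) ^ A := by
    intro z hz
    obtain ⟨C, A, r, hC, hA, hr, hb⟩ := hg z hz
    refine ⟨|c| * C, A, r, by positivity, hA, hr, fun S s hs h => ?_⟩
    calc ‖(c : ℂ) * WT S s h * GW S s h‖ = |c| * ‖WT S s h * GW S s h‖ := by
          rw [mul_assoc, norm_mul, Complex.norm_real, Real.norm_eq_abs]
      _ ≤ |c| * (C * w S * adelicHeightGL (n + n) L (h : GL (Fin (n + n)) (AdeleRing (𝓞 L) L)) ^ A) :=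
          mul_le_mul_of_nonneg_left (hb S s hs h) (abs_nonneg c)
      _ = |c| * C * w S * adelicHeightGL (n + n) L (h : GL (Fin (n + n)) (AdeleRing (𝓞 L) L)) ^ A := by ring
  have hRK : ∀ S : skewMatrices ((IsCMField.complexConj L : L ≃ₐ[Fp L] L) : L →+* L) ((gramR L e dV hdV dW hdW).map (algebraMap (Fp L) L)),
      (S : Matrix (Fin n) (Fin n) L).det ≠ 0 → ∀ (s : ℂ) (h : HA L e dV hdV dW hdW), (n : ℝ) / 2 < s.re →
        fourierCoeffDelta L e dV hdV dW hdW νN β (S : Matrix (Fin n) (Fin n) L) (eisensteinFamilyDelta L e dV hdV dW hdW f s) h =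
          (c : ℂ) * WT S s h * GW S s h := by
    intro S hdet s h hs
    rw [fourierCoeffDelta_eisensteinFamilyDelta_eq_curve e dV hdV hdV0 dW hdW hdW0 𝒦 hstd hcont wq hwq νN hβ s h
      (lintegral_tsum_enorm_mul_weight_ne_top L e dV hdV dW hdW hdV0 hdW0 hχ hs (hstd.1.1 s) (hcont s) νN hβtop hK hβK h) S.2 hdet,
      hRKW S hdet s h hs, Complex.real_smul, hc, mul_assoc]
  obtain ⟨EcW, hWoff, hWd, hWc, hWcoef, hWg⟩ := exists_whittaker_packages_fourierCoeff_fixedCarrier L hn e dV hdV dW hdW νN β f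
    (fun S s h => (c : ℂ) * WT S s h) GW hWTd' hGWd w hw0 hg'
    (fun S _ s hs => continuous_fourierCoeffDelta_eisensteinSeriesDelta L e dV hdV dW hdW hdV0 hdW0 νN hβ (S : Matrix (Fin n) (Fin n) L) hχ hs
      (hstd.1.1 s) (hcont s)) hRK ({(1 / 2 : ℂ)} : Finset ℂ)
  -- KIND 1 at the letters of record: the summable weights from (L-dec) + (L-supp) (★ p862451, once per term), then ★ p862409 §4 at THIS carrier (`hRK₁` at every carrier inside,
  -- `hRKc` ★ p861715 inside ★ p861869)
  obtain ⟨ub, hub, hubs, hbg⟩ := kindOne_weight_of_decay L hn e dV hdV dW hdW Ebc τb hτb Nb hdecb hCb hκb hsuppb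
  obtain ⟨uG, huG, huGs, haG⟩ := kindOne_weight_of_decay L hn e dV hdV dW hdW Eac τa hτa Na hdeca hCa hκa hsuppa
  obtain ⟨Ec₁, h1off, hd₁, hc₁, hcoef₁, hmaj₁, hgr₁⟩ := exists_kindOne_sixLetters_of_record L e dV hdV dW hdW hdV0 hdW0 hn hχ f hstd.1.1 hcont
    ({(1 / 2 : ℂ)} : Finset ℂ) (Finset.mem_singleton_self _) wq hwq νN hβ hβtop hK hβK Ebc hEbd Eac hEad ub uG hub huG hbg haG (hubs.add huGs) hEbc hEac
  -- KIND 0: big cell (★ p861499 over ★ p861423), middle (rescaled), identity (★ `standardFamily_growth`), O41.4 finiteness (★ ed. 4a′), assembly (★ ed. 4a)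
  have hn2 : n = 2 := by
    have h2 : Fintype.card (Fin 2 × Fin 1) = Fintype.card (Fin n) := Fintype.card_congr e
    simp only [Fintype.card_prod, Fintype.card_fin] at h2
    omega
  subst hn2
  -- KIND 0 middle term: ★ p862904 (I4 ED. 6 «ARCH-ADAPTED DATUM») from the ONE letter `hadapt`; `hχc` ★ `toHeckeCharacter_inv_conj_mul_self_eq_one`
  obtain ⟨E₇, h7d, h7c, h7eq, h7g⟩ := exists_middleTerm_package_of_standard_arch L e dV hdV dW hdW hdV0 hdW0 νN β hβ hβtop hK hβK wq hwq hχ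
    (toHeckeCharacter_inv_conj_mul_self_eq_one hlam) 𝒦 h𝒦 f hstd hcont hadapt
  -- KIND 0 big cell continuation: ★ (β) END `exists_bigCell_continuation_cm` (K2Liu-p13) from `hram` + the arch face `hArch`
  obtain ⟨E, hEd, hEeq⟩ := exists_bigCell_continuation_cm L e dV hdV dW hdW rfl hdV0 hdW0 𝒦 h𝒦 νN hlam hstd hcont hS hur hram hArch
  obtain ⟨Ec₈, h8d, h8c, h8eq, h8g⟩ :=
    exists_bigCell_termPackage_cm L e dV hdV dW hdW rfl hdV0 hdW0 𝒦 νN (toHeckeCharacter L lam⁻¹) hχ f hstd hcont hS hur E hEd hEeq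
  obtain ⟨h8d', h8c', h8eq', h8g'⟩ := smul_package (fun h : HA L e dV hdV dW hdW => adelicHeightGL (2 + 2) L (h : GL (Fin (2 + 2)) (AdeleRing (𝓞 L) L)))
    ((∫⁻ u, β u ∂νN).toReal⁻¹) ({(1 / 2 : ℂ)} : Finset ℂ) _ Ec₈ h8d h8c h8eq h8g
  obtain ⟨h7d', h7c', h7eq', h7g'⟩ := smul_package (fun h : HA L e dV hdV dW hdW => adelicHeightGL (2 + 2) L (h : GL (Fin (2 + 2)) (AdeleRing (𝓞 L) L)))
    ((∫⁻ u, β u ∂νN).toReal⁻¹) ({(1 / 2 : ℂ)} : Finset ℂ) _ E₇ h7d h7c h7eq h7g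
  obtain ⟨Ec₀, hd₀, hc₀, hcoef₀, hbd₀, hgr₀⟩ := exists_constantTerm_package L e dV hdV dW hdW hn νN hβ hβ0 hβtop wq hwq f hstd.1.1 hcont
    (fun h => (hstd.1.2 h).differentiableOn) (standardFamily_growth L e dV hdV dW hdW 𝒦 hχ f hstd hcont)
    (fun s h hs => lintegral_tsum_enorm_mul_weight_ne_top L e dV hdV dW hdW hdV0 hdW0 hχ hs (hstd.1.1 s) (hcont s) νN hβtop hK hβK h)
    ({(1 / 2 : ℂ)} : Finset ℂ) (fun s h => (∫⁻ u, β u ∂νN).toReal⁻¹ • Ec₈ s h) h8d' h8c' h8eq' h8g' (fun s h => (∫⁻ u, β u ∂νN).toReal⁻¹ • E₇ s h) h7d' h7c' h7eq' h7g'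
  -- ★ edition 3b at `P := {½}`
  exact siegelEisensteinContinuation_of_kinds_fixedCarrier_poleSet L e dV hdV hdV0 dW hdW hdW0 lam hlam hw 𝒦 h𝒦 f hstd hcont νN β hβ hβ0 hβtop ({(1 / 2 : ℂ)} : Finset ℂ)
    Ec₀ hd₀ hc₀ hcoef₀ hbd₀ hgr₀ Ec₁ h1off hd₁ hc₁ (hcoef₁ νN β hβ hβ0 hβtop) hmaj₁ hgr₁
    EcW hWoff hWd hWc hWcoef
    (whittaker_majorant_of_weightedGrowth L hn e dV hdV dW hdW EcW w hw0 hws hWg) (whittaker_summedGrowth_of_weightedGrowth L e dV hdV dW hdW EcW w hws hWg)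


end Summit.HodgeConjecture.HodgeConjecture.Cruxes.HLiu418.K2LiuSiegelEisensteinContinuationTopTwenty

end
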